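import Summits.ValiantsHypothesis.ValiantsHypothesis.Theorems.LacunarySymmetroidMatrixDescartesCensusDoorA34NullNullPairTests

/-!
# `MatrixDescartes` census — DOOR A at `(3,4)`: the ORIENTED END TESTS of the null-null sheet — end-cell pinning from the top end (`S₃` semidefinite pins the
# cell of `S₀`) and from the bottom end (`S₀` semidefinite pins the cell of `S₃`), as decidable chamber tests with the orientation read on `c_{001}`

HONEST FRAMING.  Object-search cell `pub-symmetroid`, engine seat `val-sym-eng-2` (g5); helper rows beside the registered strata line
`Cruxes/DoorA34/Lines/strata.lean` on stmt-ValiantsHypothesis-19980 (`DoorA34 = PosRootLawAt 3 4 18`: OPEN, typed, never asserted here); third stub `stub_nullNullCeiling`.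
Companion of …NullNullEndCells (`endCell_of_nullNull_seventeen`, the orientation-free closures): here the same pinning is run in EVERY cell combination with the
orientation as a hypothesis (`sign c_e = (−1)^{ρ(e)}·sign c_{001}`):

* `endCell_bottom_of_nullNull_seventeen` — `S₀ ⪰ 0`: `c_{033} > 0 ∧ c_{003} > 0 ⇒ S₃ ⪰ 0`, `c_{033} > 0 ∧ c_{003} < 0 ⇒ S₃ ⪯ 0`, `c_{033} < 0 ⇒ S₃` indefinite;
* **`card_posRoots_le_16_of_nullNull_topEndTest`** (`S₃ ⪰ 0`; `_neg`: `S₃ ⪯ 0`) and **`card_posRoots_le_16_of_nullNull_bottomEndTest`** (`S₀ ⪰ 0`; `_neg`) — the cell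
  of the other end letter (`⪰ 0`, `⪯ 0`, or indefinite) together with the parities of `ρ(2d₀+d₃)`, `ρ(2d₃+d₀)` and the sign of `c_{001}` decide; a mismatch gives
  `Z₊ ≤ 16`.  In the seat's atlas this law family (L1) alone kills `400` of the `528` sign-killed classes of the null-null sheet (`720` classes = `80` chambers × `9`
  cells; `0` contradictions with the exact realisations).

Nothing here bounds anything else; `DoorA34` and the three stubs stay OPEN; registers unchanged; nothing on `MatrixDescartes` (stmt-ValiantsHypothesis-18050) or `VP ≠ VNP` —
VP≠VNP not moved.  [folklore] Descartes bookkeeping; elementary.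
-/

-- `Summit.ValiantsHypothesis.ValiantsHypothesis.…` repeats a component by the D-0017 layout
-- (single-conjunct summit), which the `dupNamespace` linter flags; the name is mandated.
set_option linter.dupNamespace false

namespace Summit.ValiantsHypothesis.ValiantsHypothesis.Theorems.LacunarySymmetroidMatrixDescartes.Census

open Polynomial Finset Matrix
open scoped BigOperators Polynomial Matrix

/-! ## 1. Pinning from the bottom end -/

/-- Bottom-end analogue of `top_slot_mul_dotProduct_mulVec_pos_of_nullNull_seventeen`: `S₀ ⪰ 0` with kernel vector `k ≠ 0` ⇒ `c_{00x} = tr(adj S₀·S_x)` has the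
sign of `kᵀS_xk` (`x ≠ 0`). [folklore] -/
theorem bottom_slot_mul_dotProduct_mulVec_pos_of_nullNull_seventeen (d : Fin 4 → ℕ) (hd : StrictMono d) (S : Fin 4 → Matrix (Fin 3) (Fin 3) ℝ)
    (hS : ∀ l, (S l).IsSymm) (h0 : (S 0).det = 0) (h3 : (S 3).det = 0) (hpsd : (S 0).PosSemidef) (h17 : 17 ≤ ((Matrix.det (∑ l, ((X : ℝ[X]) ^ d l) • (S l).map C)).roots.toFinset.filter (fun t => 0 < t)).card)
    {k : Fin 3 → ℝ} (hk : k ≠ 0) (hPk : S 0 *ᵥ k = 0) {x : Fin 4} (hx : x ≠ 0) :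
    0 < ((S 0).adjugate * S x).trace * (k ⬝ᵥ S x *ᵥ k) := by
  have hne := trace_adjugate_mul_ne_zero_of_nullNull_seventeen d hd S h0 h3 h17 0 x hx.symm
  have e := dotProduct_self_mul_trace_adjugate_mul (S 0) (S x) (hS 0) hPk
  have hkk : 0 < k ⬝ᵥ k := lt_of_le_of_ne (by
      simp only [dotProduct, Fin.sum_univ_three]
      nlinarith [mul_self_nonneg (k 0), mul_self_nonneg (k 1), mul_self_nonneg (k 2)])
    (Ne.symm fun h => hk (dotProduct_self_eq_zero.mp h))
  have htr0 : 0 ≤ (S 0).adjugate.trace := (adjugate_posSemidef_of_posSemidef hpsd).trace_nonneg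
  have htr : 0 < (S 0).adjugate.trace := by
    refine lt_of_le_of_ne htr0 fun h0' => ?_
    rw [← h0', zero_mul] at e
    exact hne ((mul_eq_zero.mp e).resolve_left hkk.ne')
  have e2 : (S 0).adjugate.trace * (((S 0).adjugate * S x).trace * (k ⬝ᵥ S x *ᵥ k)) = (k ⬝ᵥ k) * ((S 0).adjugate * S x).trace ^ 2 := by
    rw [pow_two, ← mul_assoc (k ⬝ᵥ k), e]; ring
  have hsq : 0 < ((S 0).adjugate * S x).trace ^ 2 := by positivity
  have hpos : 0 < (S 0).adjugate.trace * (((S 0).adjugate * S x).trace * (k ⬝ᵥ S x *ᵥ k)) := by rw [e2]; exact mul_pos hkk hsq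
  exact (pos_iff_pos_of_mul_pos hpos).1 htr

/-- **END-CELL PINNING from the bottom end (`S₀ ⪰ 0`)** on a null-null seventeen: `c_{033} > 0 ∧ c_{003} > 0 ⇒ S₃ ⪰ 0`; `c_{033} > 0 ∧ c_{003} < 0 ⇒ S₃ ⪯ 0`;
`c_{033} < 0 ⇒ S₃` in neither semidefinite cell. [folklore] -/
theorem endCell_bottom_of_nullNull_seventeen (d : Fin 4 → ℕ) (hd : StrictMono d) (S : Fin 4 → Matrix (Fin 3) (Fin 3) ℝ)
    (hS : ∀ l, (S l).IsSymm) (h0 : (S 0).det = 0) (h3 : (S 3).det = 0) (hpsd : (S 0).PosSemidef) (h17 : 17 ≤ ((Matrix.det (∑ l, ((X : ℝ[X]) ^ d l) • (S l).map C)).roots.toFinset.filter (fun t => 0 < t)).card) :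
    (0 < ((S 3).adjugate * S 0).trace → 0 < ((S 0).adjugate * S 3).trace → (S 3).PosSemidef)
    ∧ (0 < ((S 3).adjugate * S 0).trace → ((S 0).adjugate * S 3).trace < 0 → (-S 3).PosSemidef)
    ∧ (((S 3).adjugate * S 0).trace < 0 → ¬ (S 3).PosSemidef ∧ ¬ (-S 3).PosSemidef) := by
  obtain ⟨k, hk, hPk⟩ := Matrix.exists_mulVec_eq_zero_iff.mpr h0
  have rel := bottom_slot_mul_dotProduct_mulVec_pos_of_nullNull_seventeen d hd S hS h0 h3 hpsd h17 hk hPk (x := 3) (by decide)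
  refine ⟨fun hq hT => ?_, fun hq hT => ?_, fun hq => not_semidef_of_trace_adjugate_mul_neg hpsd hq⟩
  · exact posSemidef_of_sheet_signs hpsd hPk (hS 3) hq h3.symm.le (by nlinarith [rel, hT])
  · exact neg_posSemidef_of_sheet_signs hpsd hPk (hS 3) hq h3.le (by nlinarith [rel, hT])

/-! ## 2. The oriented end tests -/

/-- Signs of `c_{003}`, `c_{033}` from the orientation: on a null-null seventeen `sign c_e = (−1)^{ρ(e)}·sign c_{001}`. [folklore] -/
theorem endSlots_sign_of_nullNull_seventeen (d : Fin 4 → ℕ) (hd : StrictMono d) (S : Fin 4 → Matrix (Fin 3) (Fin 3) ℝ) (h0 : (S 0).det = 0)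
    (h3 : (S 3).det = 0) (h17 : 17 ≤ ((Matrix.det (∑ l, ((X : ℝ[X]) ^ d l) • (S l).map C)).roots.toFinset.filter (fun t => 0 < t)).card)
    (ρ : ℕ → ℕ) (hρ' : ∀ n, ρ n = ((Matrix.det (∑ l, ((X : ℝ[X]) ^ d l) • (S l).map C)).support.filter (· < n)).card) :
    (0 < (-1 : ℝ) ^ ρ (2 * d 0 + d 3) * ((S 0).adjugate * S 1).trace * ((S 0).adjugate * S 3).trace)
    ∧ (0 < (-1 : ℝ) ^ ρ (2 * d 3 + d 0) * ((S 0).adjugate * S 1).trace * ((S 3).adjugate * S 0).trace) := by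
  obtain ⟨c01, m01⟩ := coeff_square_of_nullNull_seventeen d hd S h0 h3 h17 0 1 (by decide)
  obtain ⟨c03, m03⟩ := coeff_square_of_nullNull_seventeen d hd S h0 h3 h17 0 3 (by decide)
  obtain ⟨c30, m30⟩ := coeff_square_of_nullNull_seventeen d hd S h0 h3 h17 3 0 (by decide)
  have hsharp := sharp_of_nullNull_seventeen d S h0 h3 h17
  have hrank0 := rank_subbottom_of_nullNull_seventeen d hd S h0 h3 h17
  have k1 := pow_rank_mul_coeff_mul_coeff_pos_of_sharp _ hsharp m01 m03
  have k2 := pow_rank_mul_coeff_mul_coeff_pos_of_sharp _ hsharp m01 m30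
  rw [hrank0, zero_add, ← hρ', c01, c03, ← mul_assoc] at k1
  rw [hrank0, zero_add, ← hρ', c01, c30, ← mul_assoc] at k2
  exact ⟨k1, k2⟩

/-- **TOP END TEST (`S₃ ⪰ 0`).**  With `u := (−1)^{ρ(2d₀+d₃)}·c_{001}` (sign of `c_{003}`) and `v := (−1)^{ρ(2d₃+d₀)}·c_{001}` (sign of `c_{033}`): a null-null pencil with
`S₀ ⪰ 0 ∧ (u < 0 ∨ v < 0)`, or `S₀ ⪯ 0 ∧ (u < 0 ∨ v > 0)`, or `S₀` indefinite `∧ u > 0`, has `Z₊ ≤ 16`. [folklore] -/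
theorem card_posRoots_le_16_of_nullNull_topEndTest (d : Fin 4 → ℕ) (hd : StrictMono d) (S : Fin 4 → Matrix (Fin 3) (Fin 3) ℝ)
    (hS : ∀ l, (S l).IsSymm) (h0 : (S 0).det = 0) (h3 : (S 3).det = 0) (hpsd3 : (S 3).PosSemidef)
    (ρ : ℕ → ℕ) (hρ : ∀ n, ρ n = ((((((Finset.univ : Finset (Sym (Fin 4) 3)).erase (Sym.replicate 3 3)).erase (Sym.replicate 3 0)).image
          (fun s : Sym (Fin 4) 3 => ((s : Multiset (Fin 4)).map d).sum)).filter (· < n)).card))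
    (hkill : ((S 0).PosSemidef ∧ ((-1 : ℝ) ^ ρ (2 * d 0 + d 3) * ((S 0).adjugate * S 1).trace < 0 ∨ (-1 : ℝ) ^ ρ (2 * d 3 + d 0) * ((S 0).adjugate * S 1).trace < 0))
      ∨ ((-S 0).PosSemidef ∧ ((-1 : ℝ) ^ ρ (2 * d 0 + d 3) * ((S 0).adjugate * S 1).trace < 0 ∨ 0 < (-1 : ℝ) ^ ρ (2 * d 3 + d 0) * ((S 0).adjugate * S 1).trace))
      ∨ ((¬ (S 0).PosSemidef ∧ ¬ (-S 0).PosSemidef) ∧ 0 < (-1 : ℝ) ^ ρ (2 * d 0 + d 3) * ((S 0).adjugate * S 1).trace)) :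
    ((Matrix.det (∑ l, ((X : ℝ[X]) ^ d l) • (S l).map C)).roots.toFinset.filter (fun t => 0 < t)).card ≤ 16 := by
  by_contra hlt
  have h17 : 17 ≤ ((Matrix.det (∑ l, ((X : ℝ[X]) ^ d l) • (S l).map C)).roots.toFinset.filter (fun t => 0 < t)).card := by omega
  have hρ' : ∀ n, ρ n = ((Matrix.det (∑ l, ((X : ℝ[X]) ^ d l) • (S l).map C)).support.filter (· < n)).card := fun n => by rw [hρ, sheetRank_eq_of_nullNull_seventeen d S h0 h3 h17]
  obtain ⟨k1, k2⟩ := endSlots_sign_of_nullNull_seventeen d hd S h0 h3 h17 ρ hρ'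
  obtain ⟨H1, H2, H3⟩ := endCell_of_nullNull_seventeen d hd S hS h0 h3 hpsd3 h17
  set u := (-1 : ℝ) ^ ρ (2 * d 0 + d 3) * ((S 0).adjugate * S 1).trace
  set v := (-1 : ℝ) ^ ρ (2 * d 3 + d 0) * ((S 0).adjugate * S 1).trace
  set a := ((S 0).adjugate * S 3).trace
  set b := ((S 3).adjugate * S 0).trace
  -- `a` has the sign of `u`, `b` the sign of `v`
  open scoped MatrixOrder in
  rcases hkill with ⟨hp0, hu | hv⟩ | ⟨hn0, hu | hv⟩ | ⟨⟨hnp, hnn⟩, hu⟩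
  · exact (H3 (by nlinarith [k1, hu])).1 hp0
  · have hb : b < 0 := by nlinarith [k2, hv]
    rcases lt_or_gt_of_ne (trace_adjugate_mul_ne_zero_of_nullNull_seventeen d hd S h0 h3 h17 0 3 (by decide)) with ha | ha
    · exact (H3 ha).1 hp0
    · have hN := H2 ha hb
      have hz : S 0 = 0 := le_antisymm (by simpa using hN.nonneg) hp0.nonneg
      have : a = 0 := by show ((S 0).adjugate * S 3).trace = 0; rw [hz, Matrix.adjugate_zero, Matrix.zero_mul, Matrix.trace_zero]
      exact absurd this ha.ne'
  · exact (H3 (by nlinarith [k1, hu])).2 hn0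
  · have hb : 0 < b := by nlinarith [k2, hv]
    rcases lt_or_gt_of_ne (trace_adjugate_mul_ne_zero_of_nullNull_seventeen d hd S h0 h3 h17 0 3 (by decide)) with ha | ha
    · exact (H3 ha).2 hn0
    · have hP := H1 ha hb
      have hz : S 0 = 0 := le_antisymm (by simpa using hn0.nonneg) hP.nonneg
      have : a = 0 := by show ((S 0).adjugate * S 3).trace = 0; rw [hz, Matrix.adjugate_zero, Matrix.zero_mul, Matrix.trace_zero]
      exact absurd this ha.ne'
  · have ha : 0 < a := by nlinarith [k1, hu]
    rcases lt_or_gt_of_ne (trace_adjugate_mul_ne_zero_of_nullNull_seventeen d hd S h0 h3 h17 3 0 (by decide)) with hb | hb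
    · exact hnn (H2 ha hb)
    · exact hnp (H1 ha hb)

/-- **TOP END TEST (`S₃ ⪯ 0`)**, by `S ↦ −S`: `S₀ ⪯ 0 ∧ (u > 0 ∨ v > 0)`, or `S₀ ⪰ 0 ∧ (u > 0 ∨ v < 0)`, or `S₀` indefinite `∧ u < 0` ⇒ `Z₊ ≤ 16`. [folklore] -/
theorem card_posRoots_le_16_of_nullNull_topEndTest_neg (d : Fin 4 → ℕ) (hd : StrictMono d) (S : Fin 4 → Matrix (Fin 3) (Fin 3) ℝ)
    (hS : ∀ l, (S l).IsSymm) (h0 : (S 0).det = 0) (h3 : (S 3).det = 0) (hnsd3 : (-(S 3)).PosSemidef)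
    (ρ : ℕ → ℕ) (hρ : ∀ n, ρ n = ((((((Finset.univ : Finset (Sym (Fin 4) 3)).erase (Sym.replicate 3 3)).erase (Sym.replicate 3 0)).image
          (fun s : Sym (Fin 4) 3 => ((s : Multiset (Fin 4)).map d).sum)).filter (· < n)).card))
    (hkill : ((-S 0).PosSemidef ∧ (0 < (-1 : ℝ) ^ ρ (2 * d 0 + d 3) * ((S 0).adjugate * S 1).trace ∨ 0 < (-1 : ℝ) ^ ρ (2 * d 3 + d 0) * ((S 0).adjugate * S 1).trace))
      ∨ ((S 0).PosSemidef ∧ (0 < (-1 : ℝ) ^ ρ (2 * d 0 + d 3) * ((S 0).adjugate * S 1).trace ∨ (-1 : ℝ) ^ ρ (2 * d 3 + d 0) * ((S 0).adjugate * S 1).trace < 0))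
      ∨ ((¬ (S 0).PosSemidef ∧ ¬ (-S 0).PosSemidef) ∧ (-1 : ℝ) ^ ρ (2 * d 0 + d 3) * ((S 0).adjugate * S 1).trace < 0)) :
    ((Matrix.det (∑ l, ((X : ℝ[X]) ^ d l) • (S l).map C)).roots.toFinset.filter (fun t => 0 < t)).card ≤ 16 := by
  have hc : ∀ X : Matrix (Fin 3) (Fin 3) ℝ, ((-S 0).adjugate * (-X)).trace = -(((S 0).adjugate * X).trace) := fun X => by
    rw [show (-S 0).adjugate = (S 0).adjugate from by rw [← neg_one_smul ℝ (S 0), Matrix.adjugate_smul]; simp, Matrix.mul_neg, Matrix.trace_neg]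
  have hdet : ∀ l, ((fun l => -S l) l).det = -(S l).det := fun l => by simp only [Matrix.det_neg, Fintype.card_fin]; norm_num
  have h := card_posRoots_le_16_of_nullNull_topEndTest d hd (fun l => -S l) (fun l => (hS l).neg) (by rw [hdet, h0, neg_zero]) (by rw [hdet, h3, neg_zero])
    hnsd3 ρ hρ ?_
  · rwa [posRoots_pencil_neg_three] at h
  · rw [hc, neg_neg]
    rcases hkill with ⟨hn0, hu | hv⟩ | ⟨hp0, hu | hv⟩ | ⟨⟨hnp, hnn⟩, hu⟩
    · exact Or.inl ⟨hn0, Or.inl (by rw [mul_neg]; linarith)⟩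
    · exact Or.inl ⟨hn0, Or.inr (by rw [mul_neg]; linarith)⟩
    · exact Or.inr (Or.inl ⟨by simpa using hp0, Or.inl (by rw [mul_neg]; linarith)⟩)
    · exact Or.inr (Or.inl ⟨by simpa using hp0, Or.inr (by rw [mul_neg]; linarith)⟩)
    · exact Or.inr (Or.inr ⟨⟨hnn, by simpa using hnp⟩, by rw [mul_neg]; linarith⟩)

/-- **BOTTOM END TEST (`S₀ ⪰ 0`).**  With `u, v` as above (signs of `c_{003}`, `c_{033}`): `S₃ ⪰ 0 ∧ (v < 0 ∨ u < 0)`, or `S₃ ⪯ 0 ∧ (v < 0 ∨ u > 0)`, or `S₃` indefinite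
`∧ v > 0` ⇒ `Z₊ ≤ 16`. [folklore] -/
theorem card_posRoots_le_16_of_nullNull_bottomEndTest (d : Fin 4 → ℕ) (hd : StrictMono d) (S : Fin 4 → Matrix (Fin 3) (Fin 3) ℝ)
    (hS : ∀ l, (S l).IsSymm) (h0 : (S 0).det = 0) (h3 : (S 3).det = 0) (hpsd0 : (S 0).PosSemidef)
    (ρ : ℕ → ℕ) (hρ : ∀ n, ρ n = ((((((Finset.univ : Finset (Sym (Fin 4) 3)).erase (Sym.replicate 3 3)).erase (Sym.replicate 3 0)).image
          (fun s : Sym (Fin 4) 3 => ((s : Multiset (Fin 4)).map d).sum)).filter (· < n)).card))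
    (hkill : ((S 3).PosSemidef ∧ ((-1 : ℝ) ^ ρ (2 * d 3 + d 0) * ((S 0).adjugate * S 1).trace < 0 ∨ (-1 : ℝ) ^ ρ (2 * d 0 + d 3) * ((S 0).adjugate * S 1).trace < 0))
      ∨ ((-S 3).PosSemidef ∧ ((-1 : ℝ) ^ ρ (2 * d 3 + d 0) * ((S 0).adjugate * S 1).trace < 0 ∨ 0 < (-1 : ℝ) ^ ρ (2 * d 0 + d 3) * ((S 0).adjugate * S 1).trace))
      ∨ ((¬ (S 3).PosSemidef ∧ ¬ (-S 3).PosSemidef) ∧ 0 < (-1 : ℝ) ^ ρ (2 * d 3 + d 0) * ((S 0).adjugate * S 1).trace)) :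
    ((Matrix.det (∑ l, ((X : ℝ[X]) ^ d l) • (S l).map C)).roots.toFinset.filter (fun t => 0 < t)).card ≤ 16 := by
  by_contra hlt
  have h17 : 17 ≤ ((Matrix.det (∑ l, ((X : ℝ[X]) ^ d l) • (S l).map C)).roots.toFinset.filter (fun t => 0 < t)).card := by omega
  have hρ' : ∀ n, ρ n = ((Matrix.det (∑ l, ((X : ℝ[X]) ^ d l) • (S l).map C)).support.filter (· < n)).card := fun n => by rw [hρ, sheetRank_eq_of_nullNull_seventeen d S h0 h3 h17]
  obtain ⟨k1, k2⟩ := endSlots_sign_of_nullNull_seventeen d hd S h0 h3 h17 ρ hρ'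
  obtain ⟨H1, H2, H3⟩ := endCell_bottom_of_nullNull_seventeen d hd S hS h0 h3 hpsd0 h17
  set a := ((S 0).adjugate * S 3).trace
  set b := ((S 3).adjugate * S 0).trace
  open scoped MatrixOrder in
  rcases hkill with ⟨hp3, hv | hu⟩ | ⟨hn3, hv | hu⟩ | ⟨⟨hnp, hnn⟩, hv⟩
  · exact (H3 (by nlinarith [k2, hv])).1 hp3
  · have ha : a < 0 := by nlinarith [k1, hu]
    rcases lt_or_gt_of_ne (trace_adjugate_mul_ne_zero_of_nullNull_seventeen d hd S h0 h3 h17 3 0 (by decide)) with hb | hb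
    · exact (H3 hb).1 hp3
    · have hN := H2 hb ha
      have hz : S 3 = 0 := le_antisymm (by simpa using hN.nonneg) hp3.nonneg
      have : b = 0 := by show ((S 3).adjugate * S 0).trace = 0; rw [hz, Matrix.adjugate_zero, Matrix.zero_mul, Matrix.trace_zero]
      exact absurd this hb.ne'
  · exact (H3 (by nlinarith [k2, hv])).2 hn3
  · have ha : 0 < a := by nlinarith [k1, hu]
    rcases lt_or_gt_of_ne (trace_adjugate_mul_ne_zero_of_nullNull_seventeen d hd S h0 h3 h17 3 0 (by decide)) with hb | hb
    · exact (H3 hb).2 hn3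
    · have hP := H1 hb ha
      have hz : S 3 = 0 := le_antisymm (by simpa using hn3.nonneg) hP.nonneg
      have : b = 0 := by show ((S 3).adjugate * S 0).trace = 0; rw [hz, Matrix.adjugate_zero, Matrix.zero_mul, Matrix.trace_zero]
      exact absurd this hb.ne'
  · have hb : 0 < b := by nlinarith [k2, hv]
    rcases lt_or_gt_of_ne (trace_adjugate_mul_ne_zero_of_nullNull_seventeen d hd S h0 h3 h17 0 3 (by decide)) with ha | ha
    · exact hnn (H2 hb ha)
    · exact hnp (H1 hb ha)

/-- **BOTTOM END TEST (`S₀ ⪯ 0`)**, by `S ↦ −S`. [folklore] -/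
theorem card_posRoots_le_16_of_nullNull_bottomEndTest_neg (d : Fin 4 → ℕ) (hd : StrictMono d) (S : Fin 4 → Matrix (Fin 3) (Fin 3) ℝ)
    (hS : ∀ l, (S l).IsSymm) (h0 : (S 0).det = 0) (h3 : (S 3).det = 0) (hnsd0 : (-(S 0)).PosSemidef)
    (ρ : ℕ → ℕ) (hρ : ∀ n, ρ n = ((((((Finset.univ : Finset (Sym (Fin 4) 3)).erase (Sym.replicate 3 3)).erase (Sym.replicate 3 0)).image
          (fun s : Sym (Fin 4) 3 => ((s : Multiset (Fin 4)).map d).sum)).filter (· < n)).card))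
    (hkill : ((-S 3).PosSemidef ∧ (0 < (-1 : ℝ) ^ ρ (2 * d 3 + d 0) * ((S 0).adjugate * S 1).trace ∨ 0 < (-1 : ℝ) ^ ρ (2 * d 0 + d 3) * ((S 0).adjugate * S 1).trace))
      ∨ ((S 3).PosSemidef ∧ (0 < (-1 : ℝ) ^ ρ (2 * d 3 + d 0) * ((S 0).adjugate * S 1).trace ∨ (-1 : ℝ) ^ ρ (2 * d 0 + d 3) * ((S 0).adjugate * S 1).trace < 0))
      ∨ ((¬ (S 3).PosSemidef ∧ ¬ (-S 3).PosSemidef) ∧ (-1 : ℝ) ^ ρ (2 * d 3 + d 0) * ((S 0).adjugate * S 1).trace < 0)) :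
    ((Matrix.det (∑ l, ((X : ℝ[X]) ^ d l) • (S l).map C)).roots.toFinset.filter (fun t => 0 < t)).card ≤ 16 := by
  have hc : ∀ X : Matrix (Fin 3) (Fin 3) ℝ, ((-S 0).adjugate * (-X)).trace = -(((S 0).adjugate * X).trace) := fun X => by
    rw [show (-S 0).adjugate = (S 0).adjugate from by rw [← neg_one_smul ℝ (S 0), Matrix.adjugate_smul]; simp, Matrix.mul_neg, Matrix.trace_neg]
  have hdet : ∀ l, ((fun l => -S l) l).det = -(S l).det := fun l => by simp only [Matrix.det_neg, Fintype.card_fin]; norm_num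
  have h := card_posRoots_le_16_of_nullNull_bottomEndTest d hd (fun l => -S l) (fun l => (hS l).neg) (by rw [hdet, h0, neg_zero]) (by rw [hdet, h3, neg_zero])
    hnsd0 ρ hρ ?_
  · rwa [posRoots_pencil_neg_three] at h
  · rw [hc, neg_neg]
    rcases hkill with ⟨hn3, hv | hu⟩ | ⟨hp3, hv | hu⟩ | ⟨⟨hnp, hnn⟩, hv⟩
    · exact Or.inl ⟨hn3, Or.inl (by rw [mul_neg]; linarith)⟩
    · exact Or.inl ⟨hn3, Or.inr (by rw [mul_neg]; linarith)⟩
    · exact Or.inr (Or.inl ⟨by simpa using hp3, Or.inl (by rw [mul_neg]; linarith)⟩)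
    · exact Or.inr (Or.inl ⟨by simpa using hp3, Or.inr (by rw [mul_neg]; linarith)⟩)
    · exact Or.inr (Or.inr ⟨⟨hnn, by simpa using hnp⟩, by rw [mul_neg]; linarith⟩)

end Summit.ValiantsHypothesis.ValiantsHypothesis.Theorems.LacunarySymmetroidMatrixDescartes.Census
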